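import Literature.MathematicalPhysics.QuantumFieldTheory.Balaban1983to89.B16Ineq17NearFlatOneSided

/-!
# `Balaban1983to89.B16Ineq17NearFlatOneSidedDatum` — [Balaban1989LargeFieldII] (1.7) pp. 357–358 at a near-flat background, one-sided (sequel of
# `B16Ineq17NearFlatOneSided`): the AFFINE-DATUM hypothesis of the value-Hessian skeleton DISCHARGED from the definition of the family
# («`B′ ↦ A(U_{k,Z}((exp iB′)V_k))`» is parametrised by its own datum; the implicit family of constrained critical points satisfies `Φ(γ g) = g`),
# and POLARISATION for consumers holding only diagonal (ray) second-variation letters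

statement-level skeleton of published theorems with citation tags; proofs where landed; nothing here is a claim about
the Yang–Mills mass gap.

T. Bałaban, *Large field renormalization. II*, Commun. Math. Phys. **122** (1989) 355–392 [Balaban1989LargeFieldII], (1.3) p. 357, (1.7) p. 358, (1.12)
p. 359; T. Bałaban, Commun. Math. Phys. **102** (1985) 277–309 [Balaban1985Variational], (172)–(177) pp. 305–306; T. Bałaban, Commun. Math. Phys. **99**
(1985) 389–434 [Balaban1985BackgroundPropagators], (3.10) p. 392.

Cell pub-ymgap, HUMAN RULING D-0062 ∕ D-0149, seat `pub-ymgap-dag-n12-w4` g2 (WIDTH SEAT 4 of DAG node N12 = [B15]; key K1⁷ stmt-QuantumFields-20542, helper,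
count-neutral).  CONSUMED BY NAME: this seat's `B16Ineq17NearFlatOneSided` (p593499: `hessian_value_criticalFamily_ge_flatMin_sub`, `abs_bilin_diag_sub_le`);
the SECTION shape `Φ(γ g) = g` is dag-n12-w1's `Literature.Analysis.Calculus.ConstrainedCriticalFamily.exists_criticalFamily` output (cited, not imported);
the diagonal (ray) letters are dag-n12-w2's `Node00.abs_deriv_deriv_wilsonAction4_expChart_le` ∕ `…_le_l2` ∕ `…_sub_flat_le_l2` (p587195 ∕ p593907; cited, not
imported).

WHAT THIS FILE PROVES (THEOREMS ONLY — no `def`, no `sorry`; axioms standard).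
§1 `fderiv_fderiv_datum_eq_zero_of_eventually_affine` (a datum map AFFINE near `g₀` — the family DEFINED by its datum, print's `B′` —
   has `D²(Φ∘γ)(g₀) = 0`: the hypothesis `haff` of the prequel's §2–§3 DISCHARGED), `fderiv_fderiv_datum_eq_zero_of_section` (the implicit family's own identity
   `Φ(γ g) = g` — dag-n12-w1's `ConstrainedCriticalFamily.exists_criticalFamily` output — is the case `ℓ = id`), ★★
   `hessian_value_criticalFamily_ge_flatMin_sub_of_datumAffine` ∕ `…_of_section` (the prequel's §2 without `haff`; the second for the family parametrised by its datum),
   `abs_bilin_le_of_symm_of_diag` (POLARISATION: a symmetric form with the diagonal ∕ ray bound `|B(w,w)| ≤ β′‖w‖²` — the shape of the tree's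
   second-variation letters — has `|B(u,v)| ≤ 2β′‖u‖‖v‖`, i.e. letter (β) with `β = 2β′`), `abs_bilin_diag_sub_le_of_diag`.

HONEST SCOPE.  Calculus bookkeeping (an eventually-affine map has zero second derivative) and one polarisation inequality; the letters of the skeleton stay
DISPLAYED; nothing of Bałaban's asserted; count-neutral; N12 NOT discharged; K1⁷ NOT closed; one finite 𝕋⁴ programme at fixed `ε`; R4 closes the
conditional finite-𝕋⁴ rung `BalabanLadder.UV` only — the Yang–Mills mass gap (Clay) is NOT proved by any of this; nothing continuum ∕ ℝ⁴ ∕ OS.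
-/

noncomputable section

open Filter Topology Set
open scoped Topology

namespace Literature.MathematicalPhysics.QuantumFieldTheory.Balaban1983to89.B16Ineq17NearFlatOneSidedDatum

open B16Ineq17NearFlatOneSided (hessian_value_criticalFamily_ge_flatMin_sub abs_bilin_diag_sub_le)

/-! ## §1  Discharging the affine-datum hypothesis from the DEFINITION of the family; polarisation for consumers holding only
diagonal (ray) letters -/

section AffineDatum

variable {E V G : Type*} [NormedAddCommGroup E] [NormedSpace ℝ E]
  [NormedAddCommGroup V] [NormedSpace ℝ V]
  [NormedAddCommGroup G] [NormedSpace ℝ G]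

omit [NormedAddCommGroup E] [NormedSpace ℝ E] in
/-- **AN AFFINE DATUM MAP HAS NO SECOND DERIVATIVE**: if the datum of the family is affine in the parameter near `g₀` — `Φ(γ g) = v₀ + ℓ(g − g₀)` eventually;
print's family `B′ ↦ U_{k,Z}((exp iB′)V_k)` is DEFINED by its datum, so in the datum's own chart `Φ ∘ γ` is the identity plus a constant — then
`D²(Φ∘γ)(g₀) = 0` (so the multiplier term `λ₀(D²(Φ∘γ)(g₀)[h,h])` of the (1.12) shape vanishes: the hypothesis `haff` of §2–§3).
[cite: Balaban1989LargeFieldII, (1.3) p.357, (1.12) p.359; Balaban1985Variational, (174) p.305 (bookkeeping)] -/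
theorem fderiv_fderiv_datum_eq_zero_of_eventually_affine {Φ : E → V} {γ : G → E} {g₀ : G} {v₀ : V} (ℓ : G →L[ℝ] V)
    (hdat : ∀ᶠ g in 𝓝 g₀, Φ (γ g) = v₀ + ℓ (g - g₀)) (h h' : G) :
    fderiv ℝ (fun g => fderiv ℝ (fun g => Φ (γ g)) g) g₀ h h' = 0 := by
  have haff : ∀ g : G, HasFDerivAt (fun g : G => v₀ + ℓ (g - g₀)) ℓ g := fun g => by
    have h1 : HasFDerivAt (fun g : G => ℓ (g - g₀)) (ℓ.comp (ContinuousLinearMap.id ℝ G)) g :=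
      ℓ.hasFDerivAt.comp g ((hasFDerivAt_id g).sub_const g₀)
    rw [ContinuousLinearMap.comp_id] at h1
    exact h1.const_add v₀
  obtain ⟨s, hs, hso, hg₀⟩ := mem_nhds_iff.mp hdat
  have hloc : (fun g => fderiv ℝ (fun g => Φ (γ g)) g) =ᶠ[𝓝 g₀] fun _ => ℓ := by
    filter_upwards [hso.mem_nhds hg₀] with g hg
    have heq : (fun g => Φ (γ g)) =ᶠ[𝓝 g] fun g => v₀ + ℓ (g - g₀) :=
      Filter.eventually_of_mem (hso.mem_nhds hg) fun g' hg' => hs hg'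
    rw [heq.fderiv_eq]
    exact (haff g).fderiv
  rw [hloc.fderiv_eq, (hasFDerivAt_const ℓ g₀).fderiv, zero_apply, zero_apply]

omit [NormedAddCommGroup E] [NormedSpace ℝ E] in
/-- **THE IMPLICIT FAMILY'S OWN IDENTITY**: a SECTION of the constraint near `g₀` — `Φ(γ g) = g` eventually, the defining identity of the implicit family of
constrained critical points (dag-n12-w1's `Literature.Analysis.Calculus.ConstrainedCriticalFamily.exists_criticalFamily`: «for `g` near `g₀`: `Φ (γ g) = g`») —
is an affine datum with `ℓ = id`, so `D²(Φ∘γ)(g₀) = 0`. [cite: Balaban1985Variational, (172)–(174) p.305; Balaban1989LargeFieldII, (1.3) p.357 (bookkeeping)] -/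
theorem fderiv_fderiv_datum_eq_zero_of_section {Φ : E → V} {γ : V → E} {g₀ : V}
    (hsec : ∀ᶠ g in 𝓝 g₀, Φ (γ g) = g) (h h' : V) :
    fderiv ℝ (fun g => fderiv ℝ (fun g => Φ (γ g)) g) g₀ h h' = 0 :=
  fderiv_fderiv_datum_eq_zero_of_eventually_affine (v₀ := g₀) (ContinuousLinearMap.id ℝ V)
    (hsec.mono fun g hg => by rw [hg, ContinuousLinearMap.id_apply, add_sub_cancel]) h h'

/-- ★★ **THE PREQUEL's §2 WITH THE AFFINE DATUM DISCHARGED**: `B16Ineq17NearFlatOneSided.hessian_value_criticalFamily_ge_flatMin_sub` for a family whose datum map is affine near `g₀`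
(`Φ(γ g) = v₀ + ℓ(g − g₀)` eventually — the family DEFINED by its datum), no `haff` hypothesis.
[cite: Balaban1989LargeFieldII, (1.7) pp.357–358, (1.12) p.359; Balaban1985Variational, (174)–(177) pp.305–306] -/
theorem hessian_value_criticalFamily_ge_flatMin_sub_of_datumAffine {a : E → ℝ} {Φ : E → V} {γ : G → E} {g₀ : G} {x₀ : E}
    (hγ₀ : γ g₀ = x₀) {γ' : G →L[ℝ] E} (hγ : HasFDerivAt γ γ' g₀) {γ₂ : G →L[ℝ] G →L[ℝ] E}
    (hγ₂ : HasFDerivAt (fun g => fderiv ℝ γ g) γ₂ g₀) (hγd : ∀ᶠ g in 𝓝 g₀, DifferentiableAt ℝ γ g)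
    {a₂ : E →L[ℝ] E →L[ℝ] ℝ} (ha₂ : HasFDerivAt (fun x => fderiv ℝ a x) a₂ x₀) (had : ∀ᶠ x in 𝓝 x₀, DifferentiableAt ℝ a x)
    {Φ₂ : E →L[ℝ] E →L[ℝ] V} (hΦ₂ : HasFDerivAt (fun x => fderiv ℝ Φ x) Φ₂ x₀) (hΦd : ∀ᶠ x in 𝓝 x₀, DifferentiableAt ℝ Φ x)
    {lam : V →L[ℝ] ℝ} (hlam : fderiv ℝ a x₀ = lam.comp (fderiv ℝ Φ x₀)) (h : G)
    {v₀ : V} (ℓ : G →L[ℝ] V) (hdat : ∀ᶠ g in 𝓝 g₀, Φ (γ g) = v₀ + ℓ (g - g₀))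
    (Bf : E →L[ℝ] E →L[ℝ] ℝ) (Lf : E →L[ℝ] V) {Rf : V → E} {δ₁ μ β ρ δ₂ : ℝ} (hβ0 : 0 ≤ β) (hρ0 : 0 ≤ ρ)
    (hβ : ∀ u v, |Bf u v| ≤ β * ‖u‖ * ‖v‖) (hRf : ∀ v, Lf (Rf v) = v) (hρ : ∀ v, ‖Rf v‖ ≤ ρ * ‖v‖)
    (hδ₂ : ‖fderiv ℝ Φ x₀ (γ' h) - Lf (γ' h)‖ ≤ δ₂ * ‖γ' h‖)
    (hδ₁ : Bf (γ' h) (γ' h) - δ₁ * ‖γ' h‖ ^ 2 ≤ a₂ (γ' h) (γ' h))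
    (hμ : lam (Φ₂ (γ' h) (γ' h)) ≤ μ * ‖γ' h‖ ^ 2)
    {m : ℝ} (hm : ∀ w', Lf w' = fderiv ℝ Φ x₀ (γ' h) → m ≤ Bf w' w') :
    m - (δ₁ + μ + β * (ρ * δ₂) * (2 + ρ * δ₂)) * ‖γ' h‖ ^ 2
      ≤ fderiv ℝ (fun g => fderiv ℝ (fun g => a (γ g)) g) g₀ h h :=
  hessian_value_criticalFamily_ge_flatMin_sub hγ₀ hγ hγ₂ hγd ha₂ had hΦ₂ hΦd hlam h
    (by rw [fderiv_fderiv_datum_eq_zero_of_eventually_affine ℓ hdat, map_zero]) Bf Lf hβ0 hρ0 hβ hRf hρ hδ₂ hδ₁ hμ hm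

/-- ★★ **THE PREQUEL's §2 FOR THE IMPLICIT FAMILY PARAMETRISED BY ITS DATUM** (`G = V`, `Φ(γ g) = g` near `g₀` — dag-n12-w1's `exists_criticalFamily` output shape; the
datum velocity of `h` is `h` itself): `m − (δ₁ + μ + βρδ₂(2 + ρδ₂))‖γ′h‖² ≤ D²(a∘γ)(g₀)[h,h]` for every `m` dominated by the flat form on the flat fibre of
`DΦ(x₀)(γ′h)`. [cite: Balaban1989LargeFieldII, (1.7) pp.357–358, (1.12) p.359; Balaban1985Variational, (172)–(177) pp.305–306] -/
theorem hessian_value_criticalFamily_ge_flatMin_sub_of_section {a : E → ℝ} {Φ : E → V} {γ : V → E} {g₀ : V} {x₀ : E}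
    (hγ₀ : γ g₀ = x₀) {γ' : V →L[ℝ] E} (hγ : HasFDerivAt γ γ' g₀) {γ₂ : V →L[ℝ] V →L[ℝ] E}
    (hγ₂ : HasFDerivAt (fun g => fderiv ℝ γ g) γ₂ g₀) (hγd : ∀ᶠ g in 𝓝 g₀, DifferentiableAt ℝ γ g)
    {a₂ : E →L[ℝ] E →L[ℝ] ℝ} (ha₂ : HasFDerivAt (fun x => fderiv ℝ a x) a₂ x₀) (had : ∀ᶠ x in 𝓝 x₀, DifferentiableAt ℝ a x)
    {Φ₂ : E →L[ℝ] E →L[ℝ] V} (hΦ₂ : HasFDerivAt (fun x => fderiv ℝ Φ x) Φ₂ x₀) (hΦd : ∀ᶠ x in 𝓝 x₀, DifferentiableAt ℝ Φ x)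
    {lam : V →L[ℝ] ℝ} (hlam : fderiv ℝ a x₀ = lam.comp (fderiv ℝ Φ x₀)) (h : V)
    (hsec : ∀ᶠ g in 𝓝 g₀, Φ (γ g) = g)
    (Bf : E →L[ℝ] E →L[ℝ] ℝ) (Lf : E →L[ℝ] V) {Rf : V → E} {δ₁ μ β ρ δ₂ : ℝ} (hβ0 : 0 ≤ β) (hρ0 : 0 ≤ ρ)
    (hβ : ∀ u v, |Bf u v| ≤ β * ‖u‖ * ‖v‖) (hRf : ∀ v, Lf (Rf v) = v) (hρ : ∀ v, ‖Rf v‖ ≤ ρ * ‖v‖)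
    (hδ₂ : ‖fderiv ℝ Φ x₀ (γ' h) - Lf (γ' h)‖ ≤ δ₂ * ‖γ' h‖)
    (hδ₁ : Bf (γ' h) (γ' h) - δ₁ * ‖γ' h‖ ^ 2 ≤ a₂ (γ' h) (γ' h))
    (hμ : lam (Φ₂ (γ' h) (γ' h)) ≤ μ * ‖γ' h‖ ^ 2)
    {m : ℝ} (hm : ∀ w', Lf w' = fderiv ℝ Φ x₀ (γ' h) → m ≤ Bf w' w') :
    m - (δ₁ + μ + β * (ρ * δ₂) * (2 + ρ * δ₂)) * ‖γ' h‖ ^ 2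
      ≤ fderiv ℝ (fun g => fderiv ℝ (fun g => a (γ g)) g) g₀ h h :=
  hessian_value_criticalFamily_ge_flatMin_sub hγ₀ hγ hγ₂ hγd ha₂ had hΦ₂ hΦd hlam h
    (by rw [fderiv_fderiv_datum_eq_zero_of_section hsec, map_zero]) Bf Lf hβ0 hρ0 hβ hRf hρ hδ₂ hδ₁ hμ hm

/-- **POLARISATION FOR DIAGONAL LETTERS**: a SYMMETRIC bilinear form with a diagonal (ray) bound `|B(w,w)| ≤ β′‖w‖²` — the shape in which the second
variations of the Wilson action are bounded in the tree (ray second derivatives `d²∕ds² A(U·e^{sX})∣₀`) — satisfies `|B(u,v)| ≤ 2β′‖u‖‖v‖`, i.e. letter (β)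
with `β = 2β′` (polarisation `4B(u,v) = B(u+v,u+v) − B(u−v,u−v)` at unit vectors, then homogeneity).
[cite: Balaban1985BackgroundPropagators, (3.10) p.392 («a bounded … operator»); Balaban1989LargeFieldII, (1.7) p.358 (bookkeeping)] -/
theorem abs_bilin_le_of_symm_of_diag (B : E →L[ℝ] E →L[ℝ] ℝ) (hsym : ∀ u v, B u v = B v u) {β' : ℝ} (hβ' : 0 ≤ β')
    (hdiag : ∀ w, |B w w| ≤ β' * ‖w‖ ^ 2) (u v : E) : |B u v| ≤ 2 * β' * ‖u‖ * ‖v‖ := by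
  -- polarisation at general vectors
  have hpol : ∀ a b : E, |B a b| ≤ β' * (‖a‖ + ‖b‖) ^ 2 / 2 := by
    intro a b
    have h4 : 4 * B a b = B (a + b) (a + b) - B (a - b) (a - b) := by
      simp only [map_add, map_sub, add_apply, sub_apply, hsym b a]
      ring
    have hsq1 : ‖a + b‖ ^ 2 ≤ (‖a‖ + ‖b‖) ^ 2 := pow_le_pow_left₀ (norm_nonneg _) (norm_add_le a b) 2
    have hsq2 : ‖a - b‖ ^ 2 ≤ (‖a‖ + ‖b‖) ^ 2 := pow_le_pow_left₀ (norm_nonneg _) (norm_sub_le a b) 2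
    have h1 := (hdiag (a + b)).trans (mul_le_mul_of_nonneg_left hsq1 hβ')
    have h2 := (hdiag (a - b)).trans (mul_le_mul_of_nonneg_left hsq2 hβ')
    have h3 : |4 * B a b| ≤ β' * (‖a‖ + ‖b‖) ^ 2 + β' * (‖a‖ + ‖b‖) ^ 2 := by
      rw [h4]
      exact (abs_sub _ _).trans (add_le_add h1 h2)
    rw [abs_mul, abs_of_pos (by norm_num : (0 : ℝ) < 4)] at h3
    linarith
  by_cases hu : u = 0
  · subst hu
    simp
  by_cases hv : v = 0
  · subst hv
    simp
  have hun : 0 < ‖u‖ := norm_pos_iff.mpr hu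
  have hvn : 0 < ‖v‖ := norm_pos_iff.mpr hv
  -- unit vectors
  have hu₁ : ‖(‖u‖⁻¹ • u : E)‖ = 1 := by rw [norm_smul, norm_inv, norm_norm, inv_mul_cancel₀ hun.ne']
  have hv₁ : ‖(‖v‖⁻¹ • v : E)‖ = 1 := by rw [norm_smul, norm_inv, norm_norm, inv_mul_cancel₀ hvn.ne']
  have hb := hpol (‖u‖⁻¹ • u) (‖v‖⁻¹ • v)
  rw [hu₁, hv₁] at hb
  have hb' : |B (‖u‖⁻¹ • u) (‖v‖⁻¹ • v)| ≤ 2 * β' := by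
    have : β' * (1 + 1 : ℝ) ^ 2 / 2 = 2 * β' := by ring
    linarith
  have hrepr : B u v = ‖u‖ * ‖v‖ * B (‖u‖⁻¹ • u) (‖v‖⁻¹ • v) := by
    have h1 : B (‖u‖⁻¹ • u) (‖v‖⁻¹ • v) = ‖u‖⁻¹ * (‖v‖⁻¹ * B u v) := by
      simp only [map_smul, smul_eq_mul, FunLike.coe_smul, Pi.smul_apply]
      ring
    rw [h1, show ‖u‖ * ‖v‖ * (‖u‖⁻¹ * (‖v‖⁻¹ * B u v)) = (‖u‖ * ‖u‖⁻¹) * (‖v‖ * ‖v‖⁻¹) * B u v by ring,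
      mul_inv_cancel₀ hun.ne', mul_inv_cancel₀ hvn.ne', one_mul, one_mul]
  rw [hrepr, abs_mul, abs_mul, abs_of_pos hun, abs_of_pos hvn]
  have := mul_le_mul_of_nonneg_left hb' (mul_nonneg hun.le hvn.le)
  linarith

/-- **MOVING THE DIAGONAL WITH DIAGONAL LETTERS ONLY**: for symmetric `B` with `|B(w,w)| ≤ β′‖w‖²`,
`|B(w′,w′) − B(w,w)| ≤ 2β′‖w′ − w‖(‖w′‖ + ‖w‖)` (the prequel's `abs_bilin_diag_sub_le` with `β = 2β′`). [cite: Balaban1989LargeFieldII, (1.7) p.358 (bookkeeping)] -/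
theorem abs_bilin_diag_sub_le_of_diag (B : E →L[ℝ] E →L[ℝ] ℝ) (hsym : ∀ u v, B u v = B v u) {β' : ℝ} (hβ' : 0 ≤ β')
    (hdiag : ∀ w, |B w w| ≤ β' * ‖w‖ ^ 2) (w w' : E) :
    |B w' w' - B w w| ≤ 2 * β' * ‖w' - w‖ * (‖w'‖ + ‖w‖) :=
  abs_bilin_diag_sub_le B (fun u v => abs_bilin_le_of_symm_of_diag B hsym hβ' hdiag u v) w w'

end AffineDatum

end Literature.MathematicalPhysics.QuantumFieldTheory.Balaban1983to89.B16Ineq17NearFlatOneSidedDatum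

end
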